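import Mathlib
import Summits.Ventures.HodgeRepro.Tier4.Target
import Summits.Ventures.HodgeRepro.Tier4.Common.TargetBall
import Summits.Ventures.HodgeRepro.Tier4.Common.TargetCalculus
import Summits.Ventures.HodgeRepro.Tier4.Common.TargetJacobian
import Summits.Ventures.HodgeRepro.Tier4.Common.AutForms
import Summits.Ventures.HodgeRepro.Tier4.Line4.MixedTransfer
import Summits.Ventures.HodgeRepro.Tier4.Line4.Forms11
import Summits.Ventures.HodgeRepro.Tier4.Line4.MixedInvariant
import Summits.Ventures.HodgeRepro.Tier4.Line4.PullbackWedge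
import Summits.Ventures.HodgeRepro.Tier4.Line4.HoloRegularity
import Summits.Ventures.HodgeRepro.Tier4.Line4.MixedClosed
import Summits.Ventures.HodgeRepro.Tier4.Line4.ExactOnBall
import Summits.Ventures.HodgeRepro.Tier4.Line4.WirtingerChain
import Summits.Ventures.HodgeRepro.Tier4.Line3.BallChangeOfVariables
import Summits.Ventures.HodgeRepro.Tier4.Line3.DomainTransfer
import Summits.Ventures.HodgeRepro.Tier4.Line4.DomainUnfold
import Summits.Ventures.HodgeRepro.Tier4.Line4.Partition
import Summits.Ventures.HodgeRepro.Tier4.Line4.QuotientTiling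

/-!
# Tier4/Line4/StokesQuotient — Stokes on the ball quotient: `∫_D ⟨ξ ∧ (dη)^{1,1}⟩ = 0` for a closed `Γ′`-invariant
`ξ` and a `Γ′`-invariant `1`-form `η` (the core of L4.0′ `pair11_descends`, V2)

Blind re-derivation cell `pub-hodge-repro`, Tier 4 (README §9–§10), seat t4-L4-p2 (prover, LINE L4, gen 0).  Tree path
`lean/Summits/Ventures/HodgeRepro/Tier4/Line4/StokesQuotient.lean`.  Imports, BY NAME, this seat's support modules
(`PullbackWedge`, `ExactOnBall`, `WirtingerChain`, `DomainUnfold`, `Partition`), t4-L4-p1's `MixedInvariant` (`jacMat`,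
`pull`), t4-L3-p1's `Line3/BallChangeOfVariables` + `Line3/DomainTransfer` (tiling), typer-1's `AutForms`
(`det_jacMat`) and typer-2's `TargetBall` / `TargetCalculus`.

WHAT IS PROVED.  `setIntegral_wedge_d11_eq_zero`: under the cocompactness (K) and proper discontinuity (P) of the ball
action (the LitCompactness shapes read on the maps `ballActions`), for a measurable fundamental domain `D`, a `(1,1)`-form
`ξ` with `C¹` coefficients on the ball, closed (`IsClosed11`) and `Γ′`-invariant (`pull φ ξ = ξ` on the ball for every
`φ ∈ ballActions`), and a `1`-form `η = Σ η¹_k dz_k + Σ η²_l dz̄_l` with `C²` coefficients on the ball and `Γ′`-invariant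
(`Jᵀ η¹ ∘ φ = η¹`, `J̄ᵀ η² ∘ φ = η²` on the ball), `∫_D ⟨ξ ∧ (dη)^{1,1}⟩ = 0`.  Proof: the density `⟨ξ ∧ (dη)^{1,1}⟩` is
`Γ′`-invariant (`wedgeCoeff11_pull` + the naturality `d11_pull1`), so with a partition function `χ`
(`exists_partition`) `∫_D ⟨ξ ∧ dη⟩ = ∫_ball χ ⟨ξ ∧ dη⟩` (`DomainUnfold`); Leibniz `χ · (dη)^{1,1} = (d(χη))^{1,1} −
(dχ ∧ η)^{1,1}`; `∫_ball ⟨ξ ∧ d(χη)⟩ = 0` (`ExactOnBall`, `χη` compactly supported in the ball); and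
`∫_ball ⟨ξ ∧ (dχ ∧ η)⟩ = ∫_D Σ_φ ⟨ξ ∧ (d(χ∘φ) ∧ η)⟩ = 0` (tiling + chain rule, `Σ_φ d(χ ∘ φ) = d(Σ_φ χ ∘ φ) = d 1 = 0`
by local finiteness).  This is exactly the content of L4.0′: `pair11_descends` follows by bilinearity of `pair11` and
`Submodule.span_induction` once the skeleton's `Z11` / `B11` are landed names.

Nothing here says anything about the status of the Hodge conjecture for CM abelian varieties, which is NOT proved
(HC_CM is NOT proved by anyone in this repository).
-/

set_option autoImplicit false

noncomputable section

open Matrix MeasureTheory NumberField Topology Set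
open scoped ComplexConjugate

namespace Summit.Ventures.HodgeRepro.Tier4.Line4

open Summit.Ventures.HodgeRepro.Tier4 Summit.Ventures.HodgeRepro.Tier4.Line3

/-! ## 5. Stokes on the ball quotient -/

section Stokes

variable {E : Type*} [Field E] {c : E ≃+* E} {H : Matrix (Fin 3) (Fin 3) E} {τ₀ : E →+* ℂ}
  {C : Matrix (Fin 3) (Fin 3) ℂ} {Γ' : Set (Matrix (Fin 3) (Fin 3) E)}

/-- **`Σ_φ (d(χ ∘ φ) ∧ η)^{1,1} = 0`** on the ball, for a locally finite partition function `χ` with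
`Σ_φ χ ∘ φ = 1` (`C¹` on the ball). -/
theorem tsum_wedge_dchi_eq_zero (hΓ : IsCongruenceSubgroup c H Γ') (hτ : ∀ x, τ₀ (c x) = conj (τ₀ x))
    (hC : IsSylvester (H.map τ₀) C) {χ : (Fin 2 → ℂ) → ℝ} (hχc : ContDiffOn ℝ 1 χ ball)
    (hpart : ∀ z ∈ ball, HasSum (fun φ : ballActions τ₀ C Γ' => χ (φ.1 z)) 1)
    (hloc : ∀ z ∈ ball, ∃ U ∈ 𝓝 z, {φ : ballActions τ₀ C Γ' | ∃ w ∈ U, χ (φ.1 w) ≠ 0}.Finite)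
    (ξ : (Fin 2 → ℂ) → Form11) (η₁ η₂ : (Fin 2 → ℂ) → (Fin 2 → ℂ)) {z : Fin 2 → ℂ} (hz : z ∈ ball) :
    ∑' φ : ballActions τ₀ C Γ', wedgeCoeff11 (ξ z) (Matrix.of fun k l =>
      dz k (fun w => (χ (φ.1 w) : ℂ)) z * η₂ z l - dzbar l (fun w => (χ (φ.1 w) : ℂ)) z * η₁ z k) = 0 := by
  classical
  obtain ⟨U, hU, hfin⟩ := hloc z hz
  -- off the finite set, the terms vanish
  have hvan : ∀ φ : ballActions τ₀ C Γ', φ ∉ hfin.toFinset →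
      (fun w => (χ (φ.1 w) : ℂ)) =ᶠ[𝓝 z] fun _ => (0 : ℂ) := by
    intro φ hφ
    filter_upwards [hU] with w hw
    by_contra h
    exact hφ (hfin.mem_toFinset.mpr ⟨w, hw, fun h0 => h (by simp [h0])⟩)
  have hterm : ∀ φ : ballActions τ₀ C Γ', φ ∉ hfin.toFinset → wedgeCoeff11 (ξ z) (Matrix.of fun k l =>
      dz k (fun w => (χ (φ.1 w) : ℂ)) z * η₂ z l - dzbar l (fun w => (χ (φ.1 w) : ℂ)) z * η₁ z k) = 0 := by
    intro φ hφ
    have h0 : ∀ k, dz k (fun w => (χ (φ.1 w) : ℂ)) z = 0 := fun k => by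
      rw [dz_congr (hvan φ hφ), dz_const]
    have h0' : ∀ k, dzbar k (fun w => (χ (φ.1 w) : ℂ)) z = 0 := fun k => by
      rw [dzbar_congr (hvan φ hφ), dzbar_const]
    simp only [h0, h0', zero_mul, sub_zero]
    exact wedgeCoeff11_of_zero _
  rw [tsum_eq_sum hterm, ← wedgeCoeff11_of_sum]
  -- the finite sum of the cut-offs is `1` near `z`
  have hdiff : ∀ φ : ballActions τ₀ C Γ', DifferentiableAt ℝ (fun w => (χ (φ.1 w) : ℂ)) z := by
    intro φ
    have h1 : DifferentiableAt ℝ χ (φ.1 z) :=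
      (hχc.differentiableOn one_ne_zero).differentiableAt
        (isOpen_ball.mem_nhds (mem_ball_of_mem_ballActions hΓ hτ hC φ.2 hz))
    have h2 : DifferentiableAt ℝ φ.1 z := (differentiableAt_of_mem_ballActions hΓ hτ hC φ.2 hz).restrictScalars ℝ
    exact Complex.ofRealCLM.differentiableAt.comp z (h1.comp z h2)
  have hone : (fun w => ∑ φ ∈ hfin.toFinset, (χ (φ.1 w) : ℂ)) =ᶠ[𝓝 z] fun _ => (1 : ℂ) := by
    filter_upwards [hU, isOpen_ball.mem_nhds hz] with w hw hwb
    have hs : ∀ φ : ballActions τ₀ C Γ', φ ∉ hfin.toFinset → χ (φ.1 w) = 0 := fun φ hφ => by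
      by_contra h
      exact hφ (hfin.mem_toFinset.mpr ⟨w, hw, h⟩)
    have h1 : ∑ φ ∈ hfin.toFinset, χ (φ.1 w) = 1 := by
      rw [← (hpart w hwb).tsum_eq]
      exact (tsum_eq_sum hs).symm
    rw [← Complex.ofReal_sum, h1, Complex.ofReal_one]
  have hsumdz : ∀ k, ∑ φ ∈ hfin.toFinset, dz k (fun w => (χ (φ.1 w) : ℂ)) z = 0 := fun k => by
    rw [← dz_finset_sum _ (fun φ _ => hdiff φ), dz_congr hone, dz_const]
  have hsumdzbar : ∀ k, ∑ φ ∈ hfin.toFinset, dzbar k (fun w => (χ (φ.1 w) : ℂ)) z = 0 := fun k => by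
    rw [← dzbar_finset_sum _ (fun φ _ => hdiff φ), dzbar_congr hone, dzbar_const]
  have hM : (Matrix.of fun k l => ∑ φ ∈ hfin.toFinset,
      (dz k (fun w => (χ (φ.1 w) : ℂ)) z * η₂ z l - dzbar l (fun w => (χ (φ.1 w) : ℂ)) z * η₁ z k)) =
      Matrix.of fun _ _ => (0 : ℂ) := by
    ext k l
    simp only [Matrix.of_apply, Finset.sum_sub_distrib, ← Finset.sum_mul, hsumdz, hsumdzbar, zero_mul, sub_zero]
  rw [hM]
  exact wedgeCoeff11_of_zero _

/-- **STOKES ON THE BALL QUOTIENT**: under the cocompactness (K) and proper discontinuity (P) of the ball action of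
`Γ′` (the shapes of `LitCompactness` read on the maps `ballActions`), for a measurable fundamental domain `D`, a
closed `Γ′`-invariant `(1,1)`-form `ξ` with `C¹` coefficients on the ball and a `Γ′`-invariant `1`-form
`η = Σ η¹_k dz_k + Σ η²_l dz̄_l` with `C²` coefficients on the ball: `∫_D ⟨ξ ∧ (dη)^{1,1}⟩ = 0`. -/
theorem setIntegral_wedge_d11_eq_zero [NumberField E] (hΓ : IsCongruenceSubgroup c H Γ')
    (hτ : ∀ x, τ₀ (c x) = conj (τ₀ x)) (hC : IsSylvester (H.map τ₀) C)
    (hcoc : ∃ K : Set (Fin 2 → ℂ), IsCompact K ∧ K ⊆ ball ∧ ∀ z ∈ ball, ∃ φ ∈ ballActions τ₀ C Γ', φ z ∈ K)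
    (hpd : ∀ K : Set (Fin 2 → ℂ), IsCompact K → K ⊆ ball →
      {φ ∈ ballActions τ₀ C Γ' | ∃ z ∈ K, φ z ∈ K}.Finite)
    {D : Set (Fin 2 → ℂ)} (hD : IsFundamentalDomainFor (ballActions τ₀ C Γ') D)
    {ξ : (Fin 2 → ℂ) → Form11} (hξs : ∀ k l, ContDiffOn ℝ 1 (fun z => ξ z k l) ball) (hξc : IsClosed11 ξ)
    (hξi : ∀ φ ∈ ballActions τ₀ C Γ', ∀ z ∈ ball, pull φ ξ z = ξ z)
    {η₁ η₂ : (Fin 2 → ℂ) → (Fin 2 → ℂ)} (hη₁ : ∀ k, ContDiffOn ℝ 2 (fun z => η₁ z k) ball)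
    (hη₂ : ∀ k, ContDiffOn ℝ 2 (fun z => η₂ z k) ball)
    (hηi : ∀ φ ∈ ballActions τ₀ C Γ', ∀ z ∈ ball,
      (jacMat φ z)ᵀ *ᵥ η₁ (φ z) = η₁ z ∧ ((jacMat φ z).map (starRingEnd ℂ))ᵀ *ᵥ η₂ (φ z) = η₂ z) :
    ∫ z in D, wedgeCoeff11 (ξ z)
      (Matrix.of fun k l => dz k (fun w => η₂ w l) z - dzbar l (fun w => η₁ w k) z) = 0 := by
  classical
  obtain ⟨χ, hχc, hχcont, hχ0, ⟨K₁, hK₁c, hK₁b, hχK₁⟩, hpart, hloc⟩ := exists_partition hΓ hτ hC hcoc hpd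
  have hη₁' : ∀ k, ContDiffOn ℝ 1 (fun z => η₁ z k) ball := fun k => (hη₁ k).of_le one_le_two
  have hη₂' : ∀ k, ContDiffOn ℝ 1 (fun z => η₂ z k) ball := fun k => (hη₂ k).of_le one_le_two
  -- the (1,1)-part of `dη`, its continuity, and the continuity of `f = ⟨ξ ∧ dη⟩`
  have hMc : ∀ k l, ContinuousOn (fun z => dz k (fun w => η₂ w l) z - dzbar l (fun w => η₁ w k) z) ball :=
    fun k l => (continuousOn_dz (hη₂' l) k).sub (continuousOn_dzbar (hη₁' k) l)
  have hξc' : ∀ k l, ContinuousOn (fun z => ξ z k l) ball := fun k l => (hξs k l).continuousOn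
  have hfc : ContinuousOn (fun z => wedgeCoeff11 (ξ z)
      (Matrix.of fun k l => dz k (fun w => η₂ w l) z - dzbar l (fun w => η₁ w k) z)) ball := by
    have : (fun z => wedgeCoeff11 (ξ z)
        (Matrix.of fun k l => dz k (fun w => η₂ w l) z - dzbar l (fun w => η₁ w k) z)) =
        fun z => -(ξ z 0 0 * (dz 1 (fun w => η₂ w 1) z - dzbar 1 (fun w => η₁ w 1) z)
          - ξ z 0 1 * (dz 1 (fun w => η₂ w 0) z - dzbar 0 (fun w => η₁ w 1) z)
          - ξ z 1 0 * (dz 0 (fun w => η₂ w 1) z - dzbar 1 (fun w => η₁ w 0) z)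
          + ξ z 1 1 * (dz 0 (fun w => η₂ w 0) z - dzbar 0 (fun w => η₁ w 0) z)) := by
      funext z; simp [wedgeCoeff11]
    rw [this]
    exact ((((hξc' 0 0).mul (hMc 1 1)).sub ((hξc' 0 1).mul (hMc 1 0))).sub ((hξc' 1 0).mul (hMc 0 1)) |>.add
      ((hξc' 1 1).mul (hMc 0 0))).neg
  -- invariance of the density and the unfolding
  have hinv : ∀ φ ∈ ballActions τ₀ C Γ', ∀ z ∈ ball, (Complex.normSq (jacDetMap φ z) : ℂ) *
      wedgeCoeff11 (ξ (φ z)) (Matrix.of fun k l => dz k (fun w => η₂ w l) (φ z) - dzbar l (fun w => η₁ w k) (φ z)) =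
      wedgeCoeff11 (ξ z) (Matrix.of fun k l => dz k (fun w => η₂ w l) z - dzbar l (fun w => η₁ w k) z) :=
    fun φ hφ z hz => density_invariant hΓ hτ hC hξi hη₁' hη₂' hηi hφ hz
  rw [(setIntegral_domain_eq_integral_mul_partition hΓ hτ hC hD hfc hinv hχcont hχ0 hK₁c hK₁b hχK₁ hpart).2]
  -- Leibniz: `χ · dη = d(χη) − dχ ∧ η` on the ball
  have hχd : ∀ z ∈ ball, DifferentiableAt ℝ (fun w => (χ w : ℂ)) z := fun z hz =>
    Complex.ofRealCLM.differentiableAt.comp z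
      ((hχc.differentiableOn one_ne_zero).differentiableAt (isOpen_ball.mem_nhds hz))
  have hd1 : ∀ z ∈ ball, ∀ k, DifferentiableAt ℝ (fun w => η₁ w k) z := fun z hz k =>
    ((hη₁' k).differentiableOn one_ne_zero).differentiableAt (isOpen_ball.mem_nhds hz)
  have hd2 : ∀ z ∈ ball, ∀ k, DifferentiableAt ℝ (fun w => η₂ w k) z := fun z hz k =>
    ((hη₂' k).differentiableOn one_ne_zero).differentiableAt (isOpen_ball.mem_nhds hz)
  have hleib : ∀ z ∈ ball, (χ z : ℂ) * wedgeCoeff11 (ξ z)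
      (Matrix.of fun k l => dz k (fun w => η₂ w l) z - dzbar l (fun w => η₁ w k) z) =
      wedgeCoeff11 (ξ z) (Matrix.of fun k l => dz k (fun w => (χ w : ℂ) * η₂ w l) z -
        dzbar l (fun w => (χ w : ℂ) * η₁ w k) z) -
      wedgeCoeff11 (ξ z) (Matrix.of fun k l => dz k (fun w => (χ w : ℂ)) z * η₂ z l -
        dzbar l (fun w => (χ w : ℂ)) z * η₁ z k) := by
    intro z hz
    rw [← wedgeCoeff11_of_sub, ← wedgeCoeff11_of_mul]
    congr 1
    ext k l
    simp only [Matrix.of_apply]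
    rw [dz_mul (hχd z hz) (hd2 z hz l), dzbar_mul (hχd z hz) (hd1 z hz k)]
    ring
  rw [setIntegral_congr_fun isOpen_ball.measurableSet fun z hz => hleib z hz]
  -- integrability of the two pieces on the ball (continuous on the ball, zero off `K₁`)
  have hχ1 : ContDiffOn ℝ 1 (fun w => (χ w : ℂ)) ball := Complex.ofRealCLM.contDiff.comp_contDiffOn hχc
  have hχK₁' : ∀ z ∉ K₁, (χ z : ℂ) = 0 := fun z hz => by simp [hχK₁ z hz]
  have hprod1 : ∀ k, ContDiffOn ℝ 1 (fun w => (χ w : ℂ) * η₁ w k) ball := fun k => hχ1.mul (hη₁' k)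
  have hprod2 : ∀ k, ContDiffOn ℝ 1 (fun w => (χ w : ℂ) * η₂ w k) ball := fun k => hχ1.mul (hη₂' k)
  have hprod0 : ∀ z ∉ K₁, ∀ k, (χ z : ℂ) * η₁ z k = 0 ∧ (χ z : ℂ) * η₂ z k = 0 := fun z hz k => by
    simp [hχK₁' z hz]
  have hAc : ContinuousOn (fun z => wedgeCoeff11 (ξ z) (Matrix.of fun k l =>
      dz k (fun w => (χ w : ℂ) * η₂ w l) z - dzbar l (fun w => (χ w : ℂ) * η₁ w k) z)) ball := by
    have hMc' : ∀ k l, ContinuousOn (fun z => dz k (fun w => (χ w : ℂ) * η₂ w l) z -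
        dzbar l (fun w => (χ w : ℂ) * η₁ w k) z) ball :=
      fun k l => (continuousOn_dz (hprod2 l) k).sub (continuousOn_dzbar (hprod1 k) l)
    have : (fun z => wedgeCoeff11 (ξ z) (Matrix.of fun k l =>
        dz k (fun w => (χ w : ℂ) * η₂ w l) z - dzbar l (fun w => (χ w : ℂ) * η₁ w k) z)) =
        fun z => -(ξ z 0 0 * (dz 1 (fun w => (χ w : ℂ) * η₂ w 1) z - dzbar 1 (fun w => (χ w : ℂ) * η₁ w 1) z)
          - ξ z 0 1 * (dz 1 (fun w => (χ w : ℂ) * η₂ w 0) z - dzbar 0 (fun w => (χ w : ℂ) * η₁ w 1) z)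
          - ξ z 1 0 * (dz 0 (fun w => (χ w : ℂ) * η₂ w 1) z - dzbar 1 (fun w => (χ w : ℂ) * η₁ w 0) z)
          + ξ z 1 1 * (dz 0 (fun w => (χ w : ℂ) * η₂ w 0) z - dzbar 0 (fun w => (χ w : ℂ) * η₁ w 0) z)) := by
      funext z; simp [wedgeCoeff11]
    rw [this]
    exact ((((hξc' 0 0).mul (hMc' 1 1)).sub ((hξc' 0 1).mul (hMc' 1 0))).sub ((hξc' 1 0).mul (hMc' 0 1)) |>.add
      ((hξc' 1 1).mul (hMc' 0 0))).neg
  have hA0 : ∀ z ∉ K₁, wedgeCoeff11 (ξ z) (Matrix.of fun k l =>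
      dz k (fun w => (χ w : ℂ) * η₂ w l) z - dzbar l (fun w => (χ w : ℂ) * η₁ w k) z) = 0 := by
    intro z hz
    have h1 : ∀ k, ∀ w ∉ K₁, (fun w => (χ w : ℂ) * η₁ w k) w = 0 := fun k w hw => (hprod0 w hw k).1
    have h2 : ∀ k, ∀ w ∉ K₁, (fun w => (χ w : ℂ) * η₂ w k) w = 0 := fun k w hw => (hprod0 w hw k).2
    simp only [dz_eq_zero_of_notMem hK₁c.isClosed (h2 _) hz, dzbar_eq_zero_of_notMem hK₁c.isClosed (h1 _) hz,
      sub_zero]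
    exact wedgeCoeff11_of_zero _
  have hBc : ContinuousOn (fun z => wedgeCoeff11 (ξ z) (Matrix.of fun k l =>
      dz k (fun w => (χ w : ℂ)) z * η₂ z l - dzbar l (fun w => (χ w : ℂ)) z * η₁ z k)) ball := by
    have hMc' : ∀ k l, ContinuousOn (fun z => dz k (fun w => (χ w : ℂ)) z * η₂ z l -
        dzbar l (fun w => (χ w : ℂ)) z * η₁ z k) ball :=
      fun k l => ((continuousOn_dz hχ1 k).mul (hη₂' l).continuousOn).sub
        ((continuousOn_dzbar hχ1 l).mul (hη₁' k).continuousOn)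
    have : (fun z => wedgeCoeff11 (ξ z) (Matrix.of fun k l =>
        dz k (fun w => (χ w : ℂ)) z * η₂ z l - dzbar l (fun w => (χ w : ℂ)) z * η₁ z k)) =
        fun z => -(ξ z 0 0 * (dz 1 (fun w => (χ w : ℂ)) z * η₂ z 1 - dzbar 1 (fun w => (χ w : ℂ)) z * η₁ z 1)
          - ξ z 0 1 * (dz 1 (fun w => (χ w : ℂ)) z * η₂ z 0 - dzbar 0 (fun w => (χ w : ℂ)) z * η₁ z 1)
          - ξ z 1 0 * (dz 0 (fun w => (χ w : ℂ)) z * η₂ z 1 - dzbar 1 (fun w => (χ w : ℂ)) z * η₁ z 0)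
          + ξ z 1 1 * (dz 0 (fun w => (χ w : ℂ)) z * η₂ z 0 - dzbar 0 (fun w => (χ w : ℂ)) z * η₁ z 0)) := by
      funext z; simp [wedgeCoeff11]
    rw [this]
    exact ((((hξc' 0 0).mul (hMc' 1 1)).sub ((hξc' 0 1).mul (hMc' 1 0))).sub ((hξc' 1 0).mul (hMc' 0 1)) |>.add
      ((hξc' 1 1).mul (hMc' 0 0))).neg
  have hB0 : ∀ z ∉ K₁, wedgeCoeff11 (ξ z) (Matrix.of fun k l =>
      dz k (fun w => (χ w : ℂ)) z * η₂ z l - dzbar l (fun w => (χ w : ℂ)) z * η₁ z k) = 0 := by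
    intro z hz
    simp only [dz_eq_zero_of_notMem hK₁c.isClosed hχK₁' hz, dzbar_eq_zero_of_notMem hK₁c.isClosed hχK₁' hz,
      zero_mul, sub_zero]
    exact wedgeCoeff11_of_zero _
  have hAint := integrable_of_continuousOn_of_eqOn_zero isOpen_ball hK₁c hK₁b hAc hA0
  have hBint := integrable_of_continuousOn_of_eqOn_zero isOpen_ball hK₁c hK₁b hBc hB0
  rw [integral_sub hAint.integrableOn hBint.integrableOn]
  -- the exact term vanishes (ExactOnBall) and the `dχ ∧ η` term vanishes (tiling + local finiteness)
  have hA : ∫ z in ball, wedgeCoeff11 (ξ z) (Matrix.of fun k l =>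
      dz k (fun w => (χ w : ℂ) * η₂ w l) z - dzbar l (fun w => (χ w : ℂ) * η₁ w k) z) = 0 := by
    rw [setIntegral_congr_fun isOpen_ball.measurableSet fun z _ => wedgeCoeff11_comm _ _]
    exact setIntegral_ball_wedgeCoeff11_d11_eq_zero (η₁ := fun z k => (χ z : ℂ) * η₁ z k)
      (η₂ := fun z k => (χ z : ℂ) * η₂ z k) hK₁c hK₁b hprod1 hprod2
      (fun z hz => ⟨funext fun k => (hprod0 z hz k).1, funext fun k => (hprod0 z hz k).2⟩) hξs hξc
  have hB : ∫ z in ball, wedgeCoeff11 (ξ z) (Matrix.of fun k l =>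
      dz k (fun w => (χ w : ℂ)) z * η₂ z l - dzbar l (fun w => (χ w : ℂ)) z * η₁ z k) = 0 := by
    rw [integral_ball_eq_setIntegral_tsum hΓ hτ hC hD hBint
      (G := fun φ z => wedgeCoeff11 (ξ z) (Matrix.of fun k l =>
        dz k (fun w => (χ (φ.1 w) : ℂ)) z * η₂ z l - dzbar l (fun w => (χ (φ.1 w) : ℂ)) z * η₁ z k)) ?_]
    · rw [setIntegral_congr_fun hD.1 fun z hz => tsum_wedge_dchi_eq_zero hΓ hτ hC hχc hpart hloc ξ η₁ η₂ (hD.2.1 hz)]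
      simp
    · intro φ z hz
      have hzb : z ∈ ball := hD.2.1 hz
      have hφz : DifferentiableAt ℂ φ.1 z := differentiableAt_of_mem_ballActions hΓ hτ hC φ.2 hzb
      have h := wedgeCoeff11_pull φ.1 ξ
        (fun w => Matrix.of fun k l => dz k (fun w' => (χ w' : ℂ)) w * η₂ w l -
          dzbar l (fun w' => (χ w' : ℂ)) w * η₁ w k) z
      rw [hξi φ.1 φ.2 z hzb, pull_dchi_eq hΓ hτ hC φ.2 hχd (hηi φ.1 φ.2) hzb, det_jacMat_mul_conj hφz] at h
      exact h.symm
  rw [hA, hB, sub_zero]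

end Stokes

end Summit.Ventures.HodgeRepro.Tier4.Line4

end
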